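import Summits.QuantumFields.YangMills.Theorems.BalabanUVNodesN16AtRecordThm4Print
import Summits.QuantumFields.BalabanUV.T4Continuum.Support.HistoryFlow
import HarnessLib

/-!
# Route «BalabanUVNodes», cluster K4 «SpineRates» — node N16 = NE3: THE END's REGIME OF RECORD AS NAMED OBJECTS — the print-form interface slot
# `PrintSlot c`, the thresholds `radiusOfRecord N L Nper` ∕ `constOfRecord N L Nper g` (file 14's `∃ r > 0, ∃ Cof` CHOSEN, as functions of the block factor
# and the period), the proviso `InEndRegime c`, and the ONE-APPLICATION closer `InEndRegime c → PrintSlot c → N16At c`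

Cell `pub-ymgap`, seat `pub-ymgap-dag-n16-e` (R134 acceleration seat (a), strategy s2 = BY-NAME KNIT at the ₁₁ record; HUMAN RULING D-0062; chair R424 venue),
generation 0, file 1 of 2 (DEFINITIONS the route posits + their faces; file 2 `BalabanUVNodesN16AtRecord11` is the theorems-only record census that consumes
them).  `bears_on: R4∕N16 · K3 SpineGivenEndpointR11`.  Filed `--supports stmt-QuantumFields-19676`.

WHY (the RATE-RECORD HOME, seats node00-def-RR-1∕RR-2, pub-ymgap INBOX l.12026∕l.12072∕l.12136).  N16's record decl `N16At c := NE3EnergyRateWCov 4 (sfClass 4 c.L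
c.Nper c.ε) …` (module 2 `BalabanUVNodesSpineRates`) is DATUM-FREE: the Stage-11 record reaches it only through what the home `RRec₁₁ : RateRecordPred N` pins
about the NE3 sub-bundle `R.ne3`.  n16-a's closers (file 5 `n16At_of_pinned`, file 14 `n16At_of_pinned_thm4TorusAt_print`) fix `(L, Nper)` and THEN produce THE
END's thresholds `∃ r > 0, ∃ Cof ≥ 0` — but ONE home predicate over ALL four-torus families (block size `F.L`) and periods must QUOTE the thresholds, as
ADMISSIBILITY∕PROVISO clauses keyed to `F.L` (RR-2 PRE-READ §C item 2: «the home cannot close them and must not assert them; expose the letters by rfl and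
stop»).  An `∃` inside a theorem cannot be quoted; a NAME can.  This file NAMES them (choice over file 14's theorem — no new estimate) and names the 40-line
interface slot once, so that the home, the s2 knits and the consumers cite ONE identifier each:
* `PrintSlot c` — file 14's N05∕N07 interface AT THE BUNDLE: for SOME Theorem-4 constants `(c₁, B, B_h)`, leaf letters `(b′, c′)` on the two ε-free lines, an
  averaging letter `α` in the displayed window with `c.ε < α`, a (3.35) schedule `(Mc, 𝒬, C₃₃₅)` and the four k-free letter lines placing `177Bα`, `177B_hα` below
  `c.Λ₁`, `c.Λ₂'`: print's [Balaban1985RegularSpaces] THEOREM 4 IN THE ALL-TORUS GEOMETRY at every level `k ≥ 1` (`Thm4TorusAt c.L k (c.Nper·c.Lᵏ) (c.Lᵏ)⁻¹ c₁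
  unitaryUnits (Reg335Zd …) (Restr129 …) Concl_print(B, B_h)`) ∧ N07's [Balaban1985Variational] Thm 1 (8)+(10) TYPE `LeafH3sup 4 c.L c.Nper c.ε b′ c′ c.dom`;
* `radiusOfRecord N L Nper`, `constOfRecord N L Nper g` — THE END's class∕Hölder radius `r(L, Nper, N)` and constant `Cof(L, Nper, N, g)` of file 14, CHOSEN
  (`Classical.choose`; `0` off `2 ≤ L ∧ 1 ≤ Nper`);
* `InEndRegime c` — «`2 ≤ c.L`, `1 ≤ c.Nper`, `0 < c.g`, `0 < c.ε ≤ radiusOfRecord`, `0 ≤ c.Λ₁ ≤ radiusOfRecord`, `0 ≤ c.b ≤ c.ε∕2`, `constOfRecord ≤ c.C`» — THE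
  PROVISO the home displays for its NE3 bundle of record;
* `n16At_of_inEndRegime_printSlot : InEndRegime c → PrintSlot c → N16At c` — the ONE-APPLICATION closer; `s_N16_of_inEndRegime_printSlot` its `RRec`-generic
  form.  LOCATED (visible in the signature, not hidden): the radius is a function of the PERIOD `Nper` as well as of `L` — THE END's k-free lines carry the
  volume letter (`Spine/NE3/EndLinesNonVacuous.endLines_exists`, the `(N:ℝ)^d` term of its last line; GAPS `ne/NE3.md` R17: acceptable on ONE fixed torus) — so
  the home must key `Nper` to a period FIXED PER FAMILY (the unit-lattice period the N19∕N21 consumers read), never to a run-length-dependent one.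

CONTENT: 4 `def` (`PrintSlot`, `radiusOfRecord`, `constOfRecord`, `InEndRegime`), 0 `sorry`, 0 `instance`, 0 `notation`; theorems `printSlot_iff` ∕ `inEndRegime_iff`
(`Iff.rfl`), `regime_spec` (the chosen package), `radiusOfRecord_pos`, `constOfRecord_nonneg`, `n16At_of_inEndRegime_printSlot`, `s_N16_of_inEndRegime_printSlot`,
`inEndRegime_iff_of_familyL` (the proviso with `c.L = F.L`: `2 ≤ c.L` is the family's — `HistoryFlow.two_le_L`, [Balaban1987RG1] p. 251 «L > 11»).

HONEST FRAMING.  Definitions by choice over a LANDED theorem + `Iff.rfl` faces; no estimate; the slot's two interfaces ([Balaban1985RegularSpaces] Thm 4 +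
Prop 3 torus case at curved backgrounds — N05's; [Balaban1985Variational] Thm 1 (8)+(10) — N07's) are HYPOTHESES, proved nowhere in the tree; no `RRec` home
exists yet ⇒ `S_N16` NOT proved for the record; **N16 ∕ NE3 is NOT discharged**; count-neutral; one finite four-torus at fixed ε — NOT ℝ⁴, NOT infinite volume,
NOT OS, NOT a mass gap, NOT Clay.
-/

set_option autoImplicit false

open scoped BigOperators Matrix Matrix.Norms.L2Operator
open NormedSpace

namespace Summit.QuantumFields.YangMills.BalabanUVNodes.N16Regime

open Literature.MathematicalPhysics.QuantumFieldTheory.Balaban1983to89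
open Literature.MathematicalPhysics.QuantumFieldTheory.Balaban1983to89.T4Continuum (T4Family ULoop)
open B7Prop1Explicit B7Prop2Explicit
open T4AveragingDeficitWall (Ad)
open B7Eq92Concrete (mgauge)
open B8Ineq132 (covDerivFwd)
open B8Eq184Proof (cfgExp)
open B8Eq119TwistedAxial (Restr129)
open B8Eq133Hypotheses (Reg335Zd)
open B8Eq138LandauZd (covLap IsLandau138)
open B8Thm4TorusAt (torusLam Thm4TorusAt)
open Summit.QuantumFields.BalabanUV.T4Continuum
open MinimalActionRate (sfClass)
open BlockAverageCurrent (curConst)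
open NE3EnergyWeightedCovShape (NE3EnergyRateWCov)
open NE3RightInverseSupLetters (frameC)
open NE3.LeafIndexSockets (LeafH3sup)
open YMDAG.UVSplit (Datum NE3Carriers RateCarriers RateRecordPred N16At S_N16)
open Summit.QuantumFields.YangMills.BalabanUVNodes.N16AtRecord (n16At_of_pinned_thm4TorusAt_print)

noncomputable section

/-! ## §1 The print-form interface slot at a bundle, NAMED -/

/-- **THE PRINT-FORM INTERFACE SLOT AT A BUNDLE `c : NE3Carriers N`** — file 14's N05∕N07 hypothesis, verbatim, as ONE name: for SOME Theorem-4 constants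
`(c₁, B, B_h)`, leaf letters `(b′, c′)` on the two ε-free lines, an averaging letter `α` in the displayed window with `c.ε < α`, a (3.35) schedule `(Mc, 𝒬, C₃₃₅)`
and the four k-free letter lines, [Balaban1985RegularSpaces] THEOREM 4 HOLDS IN THE ALL-TORUS GEOMETRY at every level `k ≥ 1` in the form `Thm4TorusAt c.L k
(c.Nper·c.Lᵏ) (c.Lᵏ)⁻¹ c₁ unitaryUnits (Reg335Zd … (𝒬 k) C₃₃₅) (Restr129 c.L k (torusLam k)) Concl_print(B, B_h)`, AND N07's interface `LeafH3sup 4 c.L c.Nper c.ε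
b′ c′ c.dom` ([Balaban1985Variational] Thm 1 (8)+(10) TYPE) holds.  A hypothesis SHAPE — asserted for no bundle here. [folklore] -/
@[folklore]
def PrintSlot {N : ℕ} (c : NE3Carriers N) : Prop :=
  ∃ (c₁ B Bh b' c' α Mc C335 : ℝ) (𝒬 : ℕ → Set (Set (Site 4) × ℕ)),
    0 ≤ b' ∧ 0 ≤ c' ∧ 2 ^ 15 * ((4 : ℝ) + 1) ^ 2 * ((4 : ℝ) + 4) ^ 2 * (c.L : ℝ) ^ 2 * b' ≤ 1 ∧
    23040 * (4 : ℝ) ^ 4 * (frameC 4 c.L + 4) ^ 3 * (c' + curConst 4 c.L * b' ^ 2) ≤ 1 ∧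
    0 < α ∧ C0 4 * α ≤ 1 / 3 ∧ 2 * α ≤ c2' 4 c.L ∧ 11 * (4 : ℝ) ^ 2 * α ≤ 1 / 6 ∧ α + 11 * (4 : ℝ) ^ 2 * α ≤ c₁ ∧
    (b' + 226 * (8 * ((4 : ℝ) + 1) * ((4 : ℝ) + 4)) ^ 2 * b' ^ 2) < α ∧ 4 * ((4 : ℝ) - 1) * (c' + curConst 4 c.L * b' ^ 2) < α ∧
    0 ≤ Mc ∧ (Mc + 1) * (b' + 226 * (8 * ((4 : ℝ) + 1) * ((4 : ℝ) + 4)) ^ 2 * b' ^ 2) ≤ 1 / 2 ∧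
    (∀ k, ∀ q ∈ 𝒬 k, q.2 ≤ k ∧ ∃ y : Site 4, ∀ z ∈ q.1, (l1 (z - y) : ℝ) ≤ Mc * (c.L : ℝ) ^ q.2) ∧
    2 * (Mc + 1) * (b' + 226 * (8 * ((4 : ℝ) + 1) * ((4 : ℝ) + 4)) ^ 2 * b' ^ 2) + 2 * Mc * (2 * (c' + curConst 4 c.L * b' ^ 2)) +
      4 * Mc * (1 + 2 * Mc) * (b' + 226 * (8 * ((4 : ℝ) + 1) * ((4 : ℝ) + 4)) ^ 2 * b' ^ 2) ^ 2 < C335 ∧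
    c.ε < α ∧ B * (α + 11 * (4 : ℝ) ^ 2 * α) ≤ c.Λ₁ ∧
    B * (α + 11 * (4 : ℝ) ^ 2 * α) + 2 * (b' + 226 * (8 * ((4 : ℝ) + 1) * ((4 : ℝ) + 4)) ^ 2 * b' ^ 2) * c.Λ₁ ≤ c.Λ₁ ∧
    B * (α + 11 * (4 : ℝ) ^ 2 * α) + 16 * (b' + 226 * (8 * ((4 : ℝ) + 1) * ((4 : ℝ) + 4)) ^ 2 * b' ^ 2) * (B * (α + 11 * (4 : ℝ) ^ 2 * α)) ≤ c.Λ₁ ∧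
    Bh * (α + 11 * (4 : ℝ) ^ 2 * α) + 8 * (b' + 226 * (8 * ((4 : ℝ) + 1) * ((4 : ℝ) + 4)) ^ 2 * b' ^ 2) * (B * (α + 11 * (4 : ℝ) ^ 2 * α)) ≤ c.Λ₂' ∧
    (∀ k, 1 ≤ k → Thm4TorusAt c.L k (((c.Nper * c.L ^ k : ℕ) : ℤ)) (((c.L : ℝ) ^ k)⁻¹) c₁ (unitaryUnits (Matrix (Fin N) (Fin N) ℂ))
      (Reg335Zd (((c.L : ℝ) ^ k)⁻¹) c.L (𝒬 k) C335) (Restr129 c.L k (torusLam k))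
      (fun (α₀ α₁ : ℝ) (U₀ U' : Site 4 → Fin 4 → (Matrix (Fin N) (Fin N) ℂ)ˣ) (u : Site 4 → (Matrix (Fin N) (Fin N) ℂ)ˣ) =>
        ∃ A : Site 4 → Fin 4 → Matrix (Fin N) (Fin N) ℂ,
          (∀ x μ, IsSelfAdjoint (A x μ)) ∧ (∀ (x : Site 4) (κ μ : Fin 4), A (x + (((c.Nper * c.L ^ k : ℕ) : ℤ)) • e κ) μ = A x μ) ∧
          mgauge U₀ u (cfgExp (((c.L : ℝ) ^ k)⁻¹) A) = U' ∧
          (∀ x μ, ‖A x μ‖ ≤ B * (α₀ + α₁)) ∧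
          (∀ (μ : Fin 4) (x : Site 4) (κ : Fin 4), ‖covDerivFwd (((c.L : ℝ) ^ k)⁻¹) U₀ μ (fun z => A z κ) x‖ ≤ B * (α₀ + α₁)) ∧
          IsLandau138 c.L k (((c.L : ℝ) ^ k)⁻¹) Set.univ (torusLam k) U₀ A ∧
          (∀ (μ : Fin 4) (y : Site 4) (κ : Fin 4),
            ‖Ad (U₀ y μ) (covDerivFwd (((c.L : ℝ) ^ k)⁻¹) U₀ μ (fun z => A z κ) (y + e μ)) - covDerivFwd (((c.L : ℝ) ^ k)⁻¹) U₀ μ (fun z => A z κ) y‖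
              ≤ Bh * (α₀ + α₁) * (((c.L : ℝ)⁻¹) ^ k) ^ (1 : ℝ)) ∧
          (∀ (x : Site 4) (κ : Fin 4), ‖covLap (((c.L : ℝ) ^ k)⁻¹) U₀ (fun z => A z κ) x‖ ≤ B * (α₀ + α₁)))) ∧
    LeafH3sup 4 c.L c.Nper c.ε b' c' c.dom

/-- `PrintSlot c` unfolded (`Iff.rfl`) — file 14's displayed hypothesis block at `c`'s letters. [folklore] -/
theorem printSlot_iff {N : ℕ} (c : NE3Carriers N) :
    PrintSlot c ↔
      ∃ (c₁ B Bh b' c' α Mc C335 : ℝ) (𝒬 : ℕ → Set (Set (Site 4) × ℕ)),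
        0 ≤ b' ∧ 0 ≤ c' ∧ 2 ^ 15 * ((4 : ℝ) + 1) ^ 2 * ((4 : ℝ) + 4) ^ 2 * (c.L : ℝ) ^ 2 * b' ≤ 1 ∧
        23040 * (4 : ℝ) ^ 4 * (frameC 4 c.L + 4) ^ 3 * (c' + curConst 4 c.L * b' ^ 2) ≤ 1 ∧
        0 < α ∧ C0 4 * α ≤ 1 / 3 ∧ 2 * α ≤ c2' 4 c.L ∧ 11 * (4 : ℝ) ^ 2 * α ≤ 1 / 6 ∧ α + 11 * (4 : ℝ) ^ 2 * α ≤ c₁ ∧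
        (b' + 226 * (8 * ((4 : ℝ) + 1) * ((4 : ℝ) + 4)) ^ 2 * b' ^ 2) < α ∧ 4 * ((4 : ℝ) - 1) * (c' + curConst 4 c.L * b' ^ 2) < α ∧
        0 ≤ Mc ∧ (Mc + 1) * (b' + 226 * (8 * ((4 : ℝ) + 1) * ((4 : ℝ) + 4)) ^ 2 * b' ^ 2) ≤ 1 / 2 ∧
        (∀ k, ∀ q ∈ 𝒬 k, q.2 ≤ k ∧ ∃ y : Site 4, ∀ z ∈ q.1, (l1 (z - y) : ℝ) ≤ Mc * (c.L : ℝ) ^ q.2) ∧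
        2 * (Mc + 1) * (b' + 226 * (8 * ((4 : ℝ) + 1) * ((4 : ℝ) + 4)) ^ 2 * b' ^ 2) + 2 * Mc * (2 * (c' + curConst 4 c.L * b' ^ 2)) +
          4 * Mc * (1 + 2 * Mc) * (b' + 226 * (8 * ((4 : ℝ) + 1) * ((4 : ℝ) + 4)) ^ 2 * b' ^ 2) ^ 2 < C335 ∧
        c.ε < α ∧ B * (α + 11 * (4 : ℝ) ^ 2 * α) ≤ c.Λ₁ ∧
        B * (α + 11 * (4 : ℝ) ^ 2 * α) + 2 * (b' + 226 * (8 * ((4 : ℝ) + 1) * ((4 : ℝ) + 4)) ^ 2 * b' ^ 2) * c.Λ₁ ≤ c.Λ₁ ∧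
        B * (α + 11 * (4 : ℝ) ^ 2 * α) + 16 * (b' + 226 * (8 * ((4 : ℝ) + 1) * ((4 : ℝ) + 4)) ^ 2 * b' ^ 2) * (B * (α + 11 * (4 : ℝ) ^ 2 * α)) ≤ c.Λ₁ ∧
        Bh * (α + 11 * (4 : ℝ) ^ 2 * α) + 8 * (b' + 226 * (8 * ((4 : ℝ) + 1) * ((4 : ℝ) + 4)) ^ 2 * b' ^ 2) * (B * (α + 11 * (4 : ℝ) ^ 2 * α)) ≤ c.Λ₂' ∧
        (∀ k, 1 ≤ k → Thm4TorusAt c.L k (((c.Nper * c.L ^ k : ℕ) : ℤ)) (((c.L : ℝ) ^ k)⁻¹) c₁ (unitaryUnits (Matrix (Fin N) (Fin N) ℂ))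
          (Reg335Zd (((c.L : ℝ) ^ k)⁻¹) c.L (𝒬 k) C335) (Restr129 c.L k (torusLam k))
          (fun (α₀ α₁ : ℝ) (U₀ U' : Site 4 → Fin 4 → (Matrix (Fin N) (Fin N) ℂ)ˣ) (u : Site 4 → (Matrix (Fin N) (Fin N) ℂ)ˣ) =>
            ∃ A : Site 4 → Fin 4 → Matrix (Fin N) (Fin N) ℂ,
              (∀ x μ, IsSelfAdjoint (A x μ)) ∧ (∀ (x : Site 4) (κ μ : Fin 4), A (x + (((c.Nper * c.L ^ k : ℕ) : ℤ)) • e κ) μ = A x μ) ∧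
              mgauge U₀ u (cfgExp (((c.L : ℝ) ^ k)⁻¹) A) = U' ∧
              (∀ x μ, ‖A x μ‖ ≤ B * (α₀ + α₁)) ∧
              (∀ (μ : Fin 4) (x : Site 4) (κ : Fin 4), ‖covDerivFwd (((c.L : ℝ) ^ k)⁻¹) U₀ μ (fun z => A z κ) x‖ ≤ B * (α₀ + α₁)) ∧
              IsLandau138 c.L k (((c.L : ℝ) ^ k)⁻¹) Set.univ (torusLam k) U₀ A ∧
              (∀ (μ : Fin 4) (y : Site 4) (κ : Fin 4),
                ‖Ad (U₀ y μ) (covDerivFwd (((c.L : ℝ) ^ k)⁻¹) U₀ μ (fun z => A z κ) (y + e μ)) - covDerivFwd (((c.L : ℝ) ^ k)⁻¹) U₀ μ (fun z => A z κ) y‖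
                  ≤ Bh * (α₀ + α₁) * (((c.L : ℝ)⁻¹) ^ k) ^ (1 : ℝ)) ∧
              (∀ (x : Site 4) (κ : Fin 4), ‖covLap (((c.L : ℝ) ^ k)⁻¹) U₀ (fun z => A z κ) x‖ ≤ B * (α₀ + α₁)))) ∧
        LeafH3sup 4 c.L c.Nper c.ε b' c' c.dom :=
  Iff.rfl

/-! ## §2 THE END's thresholds CHOSEN as functions of `(L, Nper)`; the proviso; the one-application closer -/

section Thresholds

variable (N : ℕ) [NeZero N]

/-- **THE END's CLASS∕HÖLDER RADIUS OF RECORD `r(L, Nper, N)`** — the `r > 0` of file 14's `n16At_of_pinned_thm4TorusAt_print` at `(L, Nper)`, CHOSEN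
(`Classical.choose`); `0` off the side conditions `2 ≤ L ∧ 1 ≤ Nper`.  The letter a `Record11`-keyed home quotes in its NE3 proviso (`c.ε ≤ r`, `c.Λ₁ ≤ r`).
A function of the PERIOD as well as of the block factor (located: THE END's k-free lines carry the volume). [folklore] -/
def radiusOfRecord (L Nper : ℕ) : ℝ :=
  if h : 2 ≤ L ∧ 1 ≤ Nper then Classical.choose (n16At_of_pinned_thm4TorusAt_print (N := N) h.1 h.2) else 0

/-- **THE END's CONSTANT OF RECORD `Cof(L, Nper, N, g)`** — the `Cof` of file 14's `n16At_of_pinned_thm4TorusAt_print` at `(L, Nper)`, CHOSEN; `0` off the side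
conditions.  The letter a `Record11`-keyed home quotes in its NE3 proviso (`Cof g ≤ c.C`) and the consumers read `c.C` against (N21's energy letter `γ`, N19's
budget). [folklore] -/
def constOfRecord (L Nper : ℕ) (g : ℝ) : ℝ :=
  if h : 2 ≤ L ∧ 1 ≤ Nper then Classical.choose (Classical.choose_spec (n16At_of_pinned_thm4TorusAt_print (N := N) h.1 h.2)).2 g else 0

variable {N}

/-- **THE END's REGIME OF RECORD AT A BUNDLE** — the PROVISO a `Record11`-keyed home displays for its NE3 bundle: block factor `≥ 2`, period `≥ 1`, positive
coupling letter, class radius and Hölder letter inside `radiusOfRecord`, regularity `0 ≤ b ≤ ε∕2`, constant at least `constOfRecord`. [folklore] -/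
@[folklore]
def InEndRegime (c : NE3Carriers N) : Prop :=
  2 ≤ c.L ∧ 1 ≤ c.Nper ∧ 0 < c.g ∧ 0 < c.ε ∧ c.ε ≤ radiusOfRecord N c.L c.Nper ∧ 0 ≤ c.Λ₁ ∧ c.Λ₁ ≤ radiusOfRecord N c.L c.Nper ∧
    0 ≤ c.b ∧ c.b ≤ c.ε / 2 ∧ constOfRecord N c.L c.Nper c.g ≤ c.C

/-- `InEndRegime c` unfolded (`Iff.rfl`). [folklore] -/
theorem inEndRegime_iff (c : NE3Carriers N) :
    InEndRegime c ↔
      2 ≤ c.L ∧ 1 ≤ c.Nper ∧ 0 < c.g ∧ 0 < c.ε ∧ c.ε ≤ radiusOfRecord N c.L c.Nper ∧ 0 ≤ c.Λ₁ ∧ c.Λ₁ ≤ radiusOfRecord N c.L c.Nper ∧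
        0 ≤ c.b ∧ c.b ≤ c.ε / 2 ∧ constOfRecord N c.L c.Nper c.g ≤ c.C :=
  Iff.rfl

/-- **THE CHOSEN PACKAGE** (`2 ≤ L`, `1 ≤ Nper`): `radiusOfRecord N L Nper > 0`, `constOfRecord N L Nper g ≥ 0` for `g > 0`, and every bundle `c` with `c.L = L`,
`c.Nper = Nper` in THE END's regime at these thresholds carrying `PrintSlot c` satisfies `N16At c` — `Classical.choose_spec` of file 14's theorem. [folklore] -/
theorem regime_spec {L Nper : ℕ} (hL : 2 ≤ L) (hN : 1 ≤ Nper) :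
    0 < radiusOfRecord N L Nper ∧ (∀ g : ℝ, 0 < g → 0 ≤ constOfRecord N L Nper g) ∧
      ∀ c : NE3Carriers N, c.L = L → c.Nper = Nper → 0 < c.g → 0 < c.ε → c.ε ≤ radiusOfRecord N L Nper → 0 ≤ c.Λ₁ →
        c.Λ₁ ≤ radiusOfRecord N L Nper → 0 ≤ c.b → c.b ≤ c.ε / 2 → constOfRecord N L Nper c.g ≤ c.C → PrintSlot c → N16At c := by
  have hspec := Classical.choose_spec (n16At_of_pinned_thm4TorusAt_print (N := N) hL hN)
  have hCof := Classical.choose_spec hspec.2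
  simp only [radiusOfRecord, constOfRecord, dif_pos (And.intro hL hN)]
  exact ⟨hspec.1, hCof.1, fun c h1 h2 hg hε hεr hs₁ hs₁r hb hbh hC hslot => hCof.2 c h1 h2 hg hε hεr hs₁ hs₁r hb hbh hC hslot⟩

/-- `radiusOfRecord N L Nper > 0` on the side conditions. [folklore] -/
theorem radiusOfRecord_pos {L Nper : ℕ} (hL : 2 ≤ L) (hN : 1 ≤ Nper) : 0 < radiusOfRecord N L Nper :=
  (regime_spec (N := N) hL hN).1

/-- `constOfRecord N L Nper g ≥ 0` for `g > 0` on the side conditions. [folklore] -/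
theorem constOfRecord_nonneg {L Nper : ℕ} (hL : 2 ≤ L) (hN : 1 ≤ Nper) {g : ℝ} (hg : 0 < g) : 0 ≤ constOfRecord N L Nper g :=
  (regime_spec (N := N) hL hN).2.1 g hg

/-- **THE ONE-APPLICATION CLOSER — `InEndRegime c → PrintSlot c → N16At c`**: a bundle in THE END's regime of record carrying the print-form interface slot
satisfies N16's record decl.  What a `Record11`-keyed home's NE3 bundle needs: its PROVISO (`InEndRegime`, displayed by the home) and its CONTENT (`PrintSlot`
= N05's Theorem 4 at the bundle's pairs + N07's `LeafH3sup` — the two in-edges, proved nowhere in the tree). [folklore] -/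
theorem n16At_of_inEndRegime_printSlot {c : NE3Carriers N} (hreg : InEndRegime c) (hslot : PrintSlot c) : N16At c := by
  obtain ⟨hL, hN, hg, hε, hεr, hs₁, hs₁r, hb, hbh, hC⟩ := hreg
  exact (regime_spec (N := N) hL hN).2.2 c rfl rfl hg hε hεr hs₁ hs₁r hb hbh hC hslot

/-- **`S_N16 RRec` FOR EVERY RATE-RECORD PREDICATE WHOSE BUNDLES ARE IN THE REGIME AND CARRY THE SLOT** (`RRec`-generic; one application per home).
[folklore] -/
theorem s_N16_of_inEndRegime_printSlot (RRec : RateRecordPred N)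
    (h : ∀ (F : T4Family) (D : Datum F N) (g₀ : ℕ → ℝ) (os : List (ULoop F)) (R : RateCarriers N), RRec F D g₀ os R →
      InEndRegime R.ne3 ∧ PrintSlot R.ne3) :
    S_N16 RRec :=
  fun F D g₀ os R hR => n16At_of_inEndRegime_printSlot (h F D g₀ os R hR).1 (h F D g₀ os R hR).2

end Thresholds

/-! ## §3 The block factor READ OFF THE FAMILY -/

/-- **Every four-torus family has block size `L ≥ 2`** (`HistoryFlow.two_le_L`; [Balaban1987RG1] p. 251 «L is an odd positive integer > 11»), so **THE PROVISO WITH THE BLOCK FACTOR KEYED TO THE FAMILY** (module 2: «block factor `L` (record: `= F.L`)») loses its first clause: for a bundle with `c.L = F.L`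
the clause `2 ≤ c.L` is the family's. [folklore] -/
theorem inEndRegime_iff_of_familyL {N : ℕ} [NeZero N] {F : T4Family} {c : NE3Carriers N} (hL : c.L = F.L) :
    InEndRegime c ↔
      1 ≤ c.Nper ∧ 0 < c.g ∧ 0 < c.ε ∧ c.ε ≤ radiusOfRecord N F.L c.Nper ∧ 0 ≤ c.Λ₁ ∧ c.Λ₁ ≤ radiusOfRecord N F.L c.Nper ∧
        0 ≤ c.b ∧ c.b ≤ c.ε / 2 ∧ constOfRecord N F.L c.Nper c.g ≤ c.C := by
  rw [inEndRegime_iff, hL]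
  exact ⟨fun h => h.2, fun h => ⟨HistoryFlow.two_le_L F, h⟩⟩

end

end Summit.QuantumFields.YangMills.BalabanUVNodes.N16Regime
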